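import Summits.QuantumFields.YangMills.Theorems.FluctuationComparisonRegPrIntLS2BetaSignedCombKill

/-!
# THE CENTRED ROOTED NORMAL FORM `rootGaugeC k U := U^{g_U}` with the SIGNED IN-BLOCK comb transporter — the additive sibling of
# `T4RootedResidualGauge.rootGauge` ordered by director-ym №515 (4) (EXIT (α) of the «TUBE TERM» ∕ W-wrap finding)

Cell `ym-nodeO-ideate` ∕ `ym-balaban-port`, DEFINER seat `ym-nodeO-def-1` (gen 35); `--kind definition --supports stmt-QuantumFields-20541 --as helper`; count-neutral.
[15] = [Balaban1985Variational], [B7] = [Balaban1985Averaging], [I] = [Balaban1987RG1].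

WHY (located, 2026-08-31).  The record's gauge normal form `T4RootedResidualGauge.rootGauge k` combs from the `k`-block centres with FORWARD legs
`steps a x μ = (x μ − a μ).val` that WRAP THE TORUS for the sites behind their centre (★ PTB-1 `rootGauge_below_centre`, p799787).  Linearised at the flat background this puts
HALF-WINDINGS of the response into the block means of the rooted potential, so the (21)-Landau representative `recordHr` of the rooted response carries a non-decaying `O(ξ)`
pure-gauge «tube term» (DEF-1 g35 finding, nodeO STATUS 2026-08-31T05:20:46Z; ◆ CRIT-1 g35 R-CRIT1-g35-2 CONCUR + three independent codes; director-ym №515: wall W-wrap, a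
DEFINITION artefact).  The cure priced (α): a CENTRED normal form whose legs are the SIGNED SHORTEST in-block displacements — print's within-block axial paths ([15] (19) p.281
«exactly one gauge transformation u satisfying R̄₀uʲ = 1», [B7] (8)); ◆ CRIT-1's control run: with centred legs the one-level d = 2 model's `|Hr − ξ·hOp|_max` drops 0.2420 → 0.0083 and
is LOCALISED.  PRIOR ART REUSED BY NAME (nothing re-declared): ym3-torus px21's `…FluctuationComparisonRegPrIntLS2BetaSignedComb` (Part I: `lineHolBack ∕ lineHolZ ∕ pathHolZ ∕
pathEndZ`, ★ `combTransporter k U x := pathHolZ U (rootOf k x) x (List.finRange d)` with SIGNED steps `(x μ).val − (a μ).val ∈ ℤ`, `combTransporter_one ∕ _embIter ∕ _gaugeAct`,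
continuity) and `…SignedCombKill` (Part II: the in-block arithmetic `val_rootOf ∕ val_rootOf_le ∕ val_rootOf_add`, the comb set, ★ `combTransporter_kill`, `combTransporter_congr`).
TIE CONVENTION: none is needed — the steps are differences of natural representatives and a block of odd side `L^k` never straddles the origin, so inside a block they ARE the
shortest signed displacements; `ZMod.valMinAbs` is not used.

WHAT THIS FILE IS (one definition + the §2 laws of `T4RootedResidualGauge` RE-DERIVED for the centred path system — its header :44–47: «every §2 law holds VERBATIM for any
root-to-x path system» — each over px21's theorems; BODY-FREEZE: `T4RootedResidualGauge`, `Node00.UkSel`, `recordBgField` and their importers are UNTOUCHED):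
* §1 ★ `rootGaugeC k U := gaugeAct (combTransporter k U) U`; `isResidual_combTransporter`, `orbitRel_rootGaugeC`, `rootGaugeC_one`.
* §2 ★ `rootGaugeC_gaugeAct_of_isResidual` (CONSTANT on residual orbits), `rootGaugeC_eq_of_orbitRel`, `rootGaugeC_rootGaugeC`, ★ `rootGaugeC_gaugeAct_blockLift` ((181)-equivariance),
  ★ `rootGaugeC_rootGauge` (centring the WRAPPING normal form gives the centred one: every `rootGauge`∕`UkSel`-valued object can be re-centred after the fact, no selector re-point),
  ★ `rootGaugeC_apply_of_mem_combSet` (the in-block AXIALITY: `rootGaugeC k U b = 1` on the comb bonds — what the wrapping form lacks).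
* §3 `continuous_rootGaugeC`; `measurable_lineHolBack ∕ _lineHolZ ∕ _pathHolZ ∕ _combTransporter_apply ∕ ★ measurable_rootGaugeC` (any measurable group structure, as T4 §2b).

HONEST FRAMING.  Group algebra on the torus (telescoping) and measurability of finite products; NOTHING of Bałaban's asserted; no estimate; no carrier of record re-pointed (the
record's `UkSel`∕`recordBgField` keep the wrapping form; the centred RESPONSE names are the sibling names file `…K0RecordFormatNamesCentred`); W-(190) — the genuine [15] Prop. 9
decay content on centred objects — is XL and unported; 27931 CLOSED·IMPLICATION-ONLY·IN TOTO (№515); K0ᴬ∕K1ᴬ∕K3ᴬ OPEN; NODE O 0∕1; COUNT 8∕28 · K 1∕4 UNMOVED; one finite torus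
at a time — NOT continuum ∕ ℝ⁴ ∕ OS; **the Yang–Mills mass gap (Clay) is NOT proved by any of this.**  No `sorry`, `instance`, `notation`; standard axioms.
-/

noncomputable section

namespace Summit.QuantumFields.YangMills.Theorems.RootedGaugeCentred

open _root_.MeasureTheory
open Literature.MathematicalPhysics.QuantumFieldTheory.Balaban1983to89
open Literature.MathematicalPhysics.QuantumFieldTheory.Balaban1983to89.B12GaugeOrbits021 (OrbitRel IsResidual gaugeAct_mul)
open Literature.MathematicalPhysics.QuantumFieldTheory.Balaban1983to89.B15DeterminingSets (embIter)
open Literature.MathematicalPhysics.QuantumFieldTheory.Balaban1983to89.B14.Eq22Determines (blockIter)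
open Literature.MathematicalPhysics.QuantumFieldTheory.Balaban1983to89.B15Eq177GaugeInvariance (blockLift)
open Literature.MathematicalPhysics.QuantumFieldTheory.Balaban1983to89.B12RTGaugeInvariance254 (gaugeAct_one')
open Literature.MathematicalPhysics.QuantumFieldTheory.Balaban1983to89.T4RootedResidualGauge (lineHol rootOf blockIter_rootOf rootGauge orbitRel_rootGauge)
open Literature.MathematicalPhysics.QuantumFieldTheory.Balaban1983to89.GaugeField (gaugeAct)
open Summit.QuantumFields.YangMills.Theorems.FluctuationComparisonRegPrIntLS2BetaSignedComb
  (lineHolBack lineHolBack_succ lineHolZ lineHolZ_natCast lineHolZ_negSucc pathHolZ combTransporter combTransporter_one combTransporter_embIter combTransporter_gaugeAct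
   continuous_combTransporter)
open Summit.QuantumFields.YangMills.Theorems.FluctuationComparisonRegPrIntLS2BetaSignedCombKill (combSet combTransporter_kill)

/-! ## §1  The centred rooted normal form -/

section Centred

variable {P : Params} {G : Type*} [GaugeGroup G]

/-- ★ **THE CENTRED ROOTED NORMAL FORM** `rootGaugeC k U := U^{g_U}`, `g_U = combTransporter k U` = the holonomy of `U` along the SIGNED in-block coordinate comb from the centre of
the `k`-block of `x` to `x` (print's within-block axial paths; no leg leaves the block, nothing wraps) — the additive sibling of the wrapping `T4RootedResidualGauge.rootGauge`.
[cite: Balaban1985Variational, (19) p.281; Balaban1985Averaging, (8) p.19] -/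
def rootGaugeC (k : ℕ) (U : GaugeField P 0 G) : GaugeField P 0 G := gaugeAct (combTransporter k U) U

/-- **`g_U` IS RESIDUAL OF LEVEL `k`** («u = 1 on T⁽ᵏ⁾»): the comb transporter is `1` at every block centre (standing range `k ≤ m + K`).
[cite: Balaban1987RG1, (0.21) p.256; Balaban1985Variational, (19) p.281] -/
theorem isResidual_combTransporter {k : ℕ} (hk : k ≤ P.m + P.K) (U : GaugeField P 0 G) : IsResidual k (combTransporter k U) :=
  fun y => combTransporter_embIter hk U y

/-- The centred normal form of `U` lies in the residual orbit of `U`. [cite: Balaban1987RG1, (0.21) p.256] -/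
theorem orbitRel_rootGaugeC {k : ℕ} (hk : k ≤ P.m + P.K) (U : GaugeField P 0 G) : OrbitRel k U (rootGaugeC k U) :=
  ⟨combTransporter k U, isResidual_combTransporter hk U, rfl⟩

/-- `rootGaugeC k 1 = 1`. [cite: Balaban1985Variational, (19) p.281 (bookkeeping)] -/
theorem rootGaugeC_one (k : ℕ) : rootGaugeC k (1 : GaugeField P 0 G) = 1 := by
  unfold rootGaugeC
  rw [combTransporter_one]
  exact gaugeAct_one' _

/-! ## §2  The normal-form laws (the T4 §2 list for the centred path system) and the in-block axiality -/

/-- ★ **THE CENTRED NORMAL FORM IS CONSTANT ON RESIDUAL ORBITS**: `(U^u)^{g_{U^u}} = U^{g_U}` for `u = 1` on `T⁽ᵏ⁾` (`g_{U^u} = g_U·u⁻¹` pointwise, since `u(root x) = 1`).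
[cite: Balaban1987RG1, (0.21) p.256; Balaban1985Variational, (19) p.281] -/
theorem rootGaugeC_gaugeAct_of_isResidual {k : ℕ} {u : GaugeTransf P 0 G} (hu : IsResidual k u) (U : GaugeField P 0 G) :
    rootGaugeC k (gaugeAct u U) = rootGaugeC k U := by
  unfold rootGaugeC
  rw [← gaugeAct_mul]
  congr 1
  funext x
  show combTransporter k (gaugeAct u U) x * u x = combTransporter k U x
  rw [combTransporter_gaugeAct, show u (rootOf k x) = 1 from hu (blockIter k x), one_mul, inv_mul_cancel_right]

/-- Two configurations in one residual orbit have the SAME centred normal form. [cite: Balaban1987RG1, (0.21) p.256] -/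
theorem rootGaugeC_eq_of_orbitRel {k : ℕ} {U U' : GaugeField P 0 G} (h : OrbitRel k U U') : rootGaugeC k U' = rootGaugeC k U := by
  obtain ⟨u, hu, rfl⟩ := h
  exact rootGaugeC_gaugeAct_of_isResidual hu U

/-- The centred normal form is idempotent (standing range). [cite: Balaban1985Variational, (19) p.281 (bookkeeping)] -/
theorem rootGaugeC_rootGaugeC {k : ℕ} (hk : k ≤ P.m + P.K) (U : GaugeField P 0 G) : rootGaugeC k (rootGaugeC k U) = rootGaugeC k U :=
  rootGaugeC_eq_of_orbitRel (orbitRel_rootGaugeC hk U)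

/-- ★ **CENTRING THE WRAPPING NORMAL FORM GIVES THE CENTRED ONE**: `rootGaugeC k (rootGauge k U) = rootGaugeC k U` — the two normal forms live on the same residual orbit
(`T4RootedResidualGauge.orbitRel_rootGauge`), so every `rootGauge`∕`UkSel`-valued object of the record can be re-centred AFTER the fact, without re-pointing the selector.
[cite: Balaban1987RG1, (0.21) p.256; Balaban1985Variational, (19) p.281] -/
theorem rootGaugeC_rootGauge {k : ℕ} (hk : k ≤ P.m + P.K) (U : GaugeField P 0 G) : rootGaugeC k (rootGauge k U) = rootGaugeC k U :=
  rootGaugeC_eq_of_orbitRel (orbitRel_rootGauge hk U)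

/-- ★ **EQUIVARIANCE UNDER BLOCK-CONSTANT LIFTS** ([15] (181) «v̄ is constant on blocks B^j(y) … and equal to v(y)»): for `v̄ = blockLift k v`,
`(U^{v̄})^{g_{U^{v̄}}} = (U^{g_U})^{v̄}` — the root of `x` lies in the block of `x`, so `v̄(root x) = v̄(x)`. [cite: Balaban1985Variational, (181) p.307] -/
theorem rootGaugeC_gaugeAct_blockLift {k : ℕ} (hk : k ≤ P.m + P.K) (v : GaugeTransf P k G) (U : GaugeField P 0 G) :
    rootGaugeC k (gaugeAct (blockLift k v) U) = gaugeAct (blockLift k v) (rootGaugeC k U) := by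
  unfold rootGaugeC
  rw [← gaugeAct_mul, ← gaugeAct_mul]
  congr 1
  funext x
  show combTransporter k (gaugeAct (blockLift k v) U) x * blockLift k v x = blockLift k v x * combTransporter k U x
  rw [combTransporter_gaugeAct, show blockLift k v (rootOf k x) = blockLift k v x from by
    show v (blockIter k (rootOf k x)) = v (blockIter k x); rw [blockIter_rootOf hk], inv_mul_cancel_right]

/-- ★ **IN-BLOCK AXIALITY** — what the wrapping form lacks: on every COMB BOND `b` of level `k` (a bond inside one `k`-block whose source has its later coordinates at the
centre, px21's `combSet k`) the centred normal form is trivial, `rootGaugeC k U b = 1` (`combTransporter_kill`). [cite: Balaban1985Variational, (19) p.281; Balaban1985RegularSpaces, (1.19) p.24] -/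
theorem rootGaugeC_apply_of_mem_combSet {k : ℕ} (hk : k ≤ P.m + P.K) (U : GaugeField P 0 G) {b : PBond P 0} (hb : b ∈ (combSet k : Set (PBond P 0))) :
    rootGaugeC k U b = 1 :=
  combTransporter_kill hk U hb

end Centred

/-! ## §3  Continuity and measurability of the centred normal form -/

section Continuity

variable {P : Params} {G : Type*} [GaugeGroup G] [TopologicalSpace G] [IsTopologicalGroup G]

omit [GaugeGroup G] [IsTopologicalGroup G] in
/-- Each bond variable is a continuous function of the configuration (product topology). [folklore] -/
private theorem continuous_apply' {j : ℕ} (b : PBond P j) : Continuous fun U : GaugeField P j G => U b :=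
  continuous_apply b

/-- **The centred normal form `U ↦ U^{g_U}` is CONTINUOUS** (finite products and inverses of bond variables). [folklore] -/
theorem continuous_rootGaugeC (k : ℕ) : Continuous (rootGaugeC k : GaugeField P 0 G → GaugeField P 0 G) := by
  refine continuous_pi fun b => ?_
  have hc := continuous_combTransporter (P := P) (G := G) k
  have hs : Continuous fun U : GaugeField P 0 G => combTransporter k U b.src := (continuous_apply b.src).comp hc
  have ht : Continuous fun U : GaugeField P 0 G => combTransporter k U b.tgt := (continuous_apply b.tgt).comp hc
  exact (hs.mul (continuous_apply' b)).mul ht.inv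

end Continuity

section Measurable

variable {P : Params} {G : Type*} [GaugeGroup G] [MeasurableSpace G] [MeasurableMul₂ G] [MeasurableInv G]

omit [GaugeGroup G] [MeasurableMul₂ G] [MeasurableInv G] in
/-- Each bond variable is a measurable function of the configuration (product σ-algebra of `Setup`). [cite: Balaban1987RG1, (0.21) p.256 (bookkeeping)] -/
private theorem measurable_apply' {j : ℕ} (b : PBond P j) : Measurable fun U : GaugeField P j G => U b :=
  measurable_pi_apply b

omit [MeasurableInv G] in
/-- Forward line holonomies are measurable in `U` (as in `T4RootedResidualGauge.measurable_lineHol`). [cite: Balaban1987RG1, (0.21) p.256 (bookkeeping)] -/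
private theorem measurable_lineHol' {j : ℕ} (a : Site P j) (μ : Fin P.d) : ∀ n, Measurable fun U : GaugeField P j G => lineHol U a μ n
  | 0 => measurable_const
  | n + 1 => (measurable_lineHol' a μ n).mul (measurable_apply' _)

/-- Backward line holonomies are measurable in `U`. [cite: Balaban1987RG1, (0.21) p.256 (bookkeeping)] -/
theorem measurable_lineHolBack {j : ℕ} (a : Site P j) (μ : Fin P.d) : ∀ n, Measurable fun U : GaugeField P j G => lineHolBack U a μ n
  | 0 => measurable_const
  | n + 1 => by
      simp only [lineHolBack_succ]
      exact (measurable_lineHolBack a μ n).mul (measurable_apply' _).inv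

/-- Signed line holonomies are measurable in `U`. [cite: Balaban1987RG1, (0.21) p.256 (bookkeeping)] -/
theorem measurable_lineHolZ {j : ℕ} (a : Site P j) (μ : Fin P.d) : ∀ n : ℤ, Measurable fun U : GaugeField P j G => lineHolZ U a μ n
  | Int.ofNat n => by
      simp only [show (Int.ofNat n : ℤ) = (n : ℤ) from rfl, lineHolZ_natCast]
      exact measurable_lineHol' a μ n
  | Int.negSucc n => by
      simp only [lineHolZ_negSucc]
      exact measurable_lineHolBack a μ (n + 1)

/-- Signed path holonomies are measurable in `U`. [cite: Balaban1987RG1, (0.21) p.256 (bookkeeping)] -/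
theorem measurable_pathHolZ {j : ℕ} : ∀ (a x : Site P j) (l : List (Fin P.d)), Measurable fun U : GaugeField P j G => pathHolZ U a x l
  | _, _, [] => measurable_const
  | a, x, μ :: l => (measurable_lineHolZ a μ _).mul (measurable_pathHolZ _ x l)

/-- The comb transporter at a site is measurable in `U`. [cite: Balaban1987RG1, (0.21) p.256 (bookkeeping)] -/
theorem measurable_combTransporter_apply (k : ℕ) (x : Site P 0) : Measurable fun U : GaugeField P 0 G => combTransporter k U x :=
  measurable_pathHolZ _ _ _

/-- ★ **The centred normal form `U ↦ U^{g_U}` is a MEASURABLE self-map of the configuration space** (so a re-centred measurable selector stays measurable).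
[cite: Balaban1987RG1, (0.21) p.256 (bookkeeping)] -/
theorem measurable_rootGaugeC (k : ℕ) : Measurable (rootGaugeC k : GaugeField P 0 G → GaugeField P 0 G) := by
  refine measurable_pi_lambda _ fun b => ?_
  exact ((measurable_combTransporter_apply k b.src).mul (measurable_apply' b)).mul (measurable_combTransporter_apply k b.tgt).inv

end Measurable

end Summit.QuantumFields.YangMills.Theorems.RootedGaugeCentred

end
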